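import Summits.AnomalousDissipation.AnomalousDissipation.Theorems.SolenoidalFractalHomogenisationLagrangianStepCellLawVOddGainDefectGram
import HarnessLib

/-!
# The STRICT reversed-Minkowski inequality — §2: the cubature word `W₀` (p5's (L4) odd-gain certificate, K1L_D helper)

Second of three files splitting planner ad-ideate-p5 g8's `Cruxes/LagrangianRenormalisationStep/OddGainDefect.lean` (afb03e3ad1f1; custody
`HOME/ad-ideate-p5/k1l-odd-defect/`, sha c541ace0…) at its section boundaries for the 400-line rule; content byte-identical to §2 of that file
(see the header of `…CellLawVOddGainDefectGram` for the mathematics): slot weights/normals `slotW`/`slotN` of `bsymb_excQS` for `cubatureWord`,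
the design identities `slotTermP_sum`/`slotTermB_sum`, the lower frame constant `slotW_perpSq_sum` (`a = c₀`), the first absolute moment
`slotW_abs_sum_le` (`B ≤ c₀√5/3`), and **`strictMinkowski_cubatureWord`** with `γ(c) = c·√5/3 < 1` for `c < 3/√5` (`gamma_lt_one`).
No named facts, no sorry. Lander: prover ad-k3l-bookkeeping-p1 g4 (tenure D24-10 fallback).
-/

set_option linter.dupNamespace false
set_option linter.style.longLine false

noncomputable section

namespace Summit.AnomalousDissipation.AnomalousDissipation.Theorems.SolenoidalFractalHomogenisation.LagrangianStep.OddGain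

open Matrix Finset
open Literature.Analysis.FluidPDE.KY (real_dot_eq)

/-! ## §2 The cubature word `W₀`: lower frame constant `a = c₀`, first absolute moment `B ≤ c₀√5/3`, `γ(c) = c·√5/3` -/

section Cubature

open Literature.Analysis Literature.Analysis.FunctionSpaces Literature.Analysis.FluidPDE
open Literature.Analysis.FluidPDE.LatticeShear
open Literature.Algebra.EuclideanLattices (inner_fin_three norm_sq_fin_three)
open scoped Real

/-- The slot weight `c_s·(e_s·κ)²` of `bsymb_excQS` (p643421/p644278) for the cubature word. -/
def slotW (κ : Fin 3 → ℝ) (s : Fin 26) : ℝ :=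
  slotCoef cubatureWord s * (∑ a, (cubatureWord.phase s).e a * κ a) ^ 2

/-- The slot normal `m̂_s` of the cubature word. -/
def slotN (s : Fin 26) : Fin 3 → ℝ := mhat (cubatureWord.phase s)

/-- `slotW_nonneg` (p5 g8, OddGainDefect §2; see the file header). -/
theorem slotW_nonneg (κ : Fin 3 → ℝ) (s : Fin 26) : 0 ≤ slotW κ s :=
  mul_nonneg (slotCoef_nonneg _ _) (sq_nonneg _)

/-- `slotN_unit` (p5 g8, OddGainDefect §2; see the file header). -/
theorem slotN_unit (s : Fin 26) : slotN s ⬝ᵥ slotN s = 1 := by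
  have h := sum_mhat_sq (cubatureWord.phase s)
  simp only [sq] at h
  simpa [dotProduct, slotN] using h

/-- `|m|²` of slot data. -/
def sqm (d : SlotData) : ℝ := (d.m 0 : ℝ) ^ 2 + d.m 1 ^ 2 + d.m 2 ^ 2

/-- closed form of `c_s(e_s·κ)²·|P_s v|²·period` in the integer slot data. -/
def slotTermP (d : SlotData) (κ v : Fin 3 → ℝ) : ℝ :=
  (d.τ : ℝ) * ((d.v 0 : ℝ) * κ 0 + d.v 1 * κ 1 + d.v 2 * κ 2) ^ 2 *
    (sqm d * (v 0 ^ 2 + v 1 ^ 2 + v 2 ^ 2) - ((d.m 0 : ℝ) * v 0 + d.m 1 * v 1 + d.m 2 * v 2) ^ 2) /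
    (2 * (2 * π) ^ 4 * d.n * sqm d ^ 3)

/-- closed form of `c_s(e_s·κ)²·(5(m̂_s·κ)² + |κ|²)·period`. -/
def slotTermB (d : SlotData) (κ : Fin 3 → ℝ) : ℝ :=
  (d.τ : ℝ) * ((d.v 0 : ℝ) * κ 0 + d.v 1 * κ 1 + d.v 2 * κ 2) ^ 2 *
    (5 * ((d.m 0 : ℝ) * κ 0 + d.m 1 * κ 1 + d.m 2 * κ 2) ^ 2 + sqm d * (κ 0 ^ 2 + κ 1 ^ 2 + κ 2 ^ 2)) /
    (2 * (2 * π) ^ 4 * d.n * sqm d ^ 3)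

/-- **Design identity 1** (frame completeness + second/fourth cubature moments):
`Σ_s c_s(e_s·κ)²|P_s v|²·period = (168|κ|²|v|² + 56(κ·v)²)/(32π⁴)`. [folklore] -/
theorem slotTermP_sum (κ v : Fin 3 → ℝ) :
    ∑ j, slotTermP (slots j) κ v =
      (168 * (κ 0 ^ 2 + κ 1 ^ 2 + κ 2 ^ 2) * (v 0 ^ 2 + v 1 ^ 2 + v 2 ^ 2) + 56 * (κ 0 * v 0 + κ 1 * v 1 + κ 2 * v 2) ^ 2) /
        (32 * π ^ 4) := by
  simp only [Fin.sum_univ_succ, Fin.sum_univ_zero, slots, slotTermP, sqm, Matrix.cons_val_zero, Matrix.cons_val_succ,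
    Matrix.cons_val_one, Matrix.head_cons, Matrix.cons_val_two, Matrix.tail_cons]
  push_cast
  field_simp
  ring

/-- **Design identity 2**: `Σ_s c_s(e_s·κ)²(5(m̂_s·κ)² + |κ|²)·period = 560|κ|⁴/(32π⁴)` (`= (5·56 + 280)|κ|⁴/(32π⁴)`). [folklore] -/
theorem slotTermB_sum (κ : Fin 3 → ℝ) :
    ∑ j, slotTermB (slots j) κ = 560 * (κ 0 ^ 2 + κ 1 ^ 2 + κ 2 ^ 2) ^ 2 / (32 * π ^ 4) := by
  simp only [Fin.sum_univ_succ, Fin.sum_univ_zero, slots, slotTermB, sqm, Matrix.cons_val_zero, Matrix.cons_val_succ,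
    Matrix.cons_val_one, Matrix.head_cons, Matrix.cons_val_two, Matrix.tail_cons]
  push_cast
  field_simp
  ring

/-- pure algebra behind `slotW_mul_perpSq`. -/
theorem slot_algebraP (τ r M sn n S V T c : ℝ) (hr : r ^ 2 = M) (hM : 0 < M) (hsn : sn ^ 2 = n) (hn : 0 < n) (hc : 0 < c) :
    τ / (2 * (c * r) ^ 4) * ((1 / sn) * S) ^ 2 * (V - (T / r) ^ 2) = τ * S ^ 2 * (M * V - T ^ 2) / (2 * c ^ 4 * n * M ^ 3) := by
  have hr0 : r ≠ 0 := by rintro rfl; simp at hr; linarith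
  have hsn0 : sn ≠ 0 := by rintro rfl; simp at hsn; linarith
  have hr4 : (c * r) ^ 4 = c ^ 4 * M ^ 2 := by rw [mul_pow, show r ^ 4 = (r ^ 2) ^ 2 by ring, hr]
  have e2 : ((1 / sn) * S) ^ 2 = S ^ 2 / n := by rw [mul_pow, one_div, inv_pow, hsn]; ring
  have e3 : (T / r) ^ 2 = T ^ 2 / M := by rw [div_pow, hr]
  rw [hr4, e2, e3]
  field_simp

/-- pure algebra behind `slotW_mul_moment`. -/
theorem slot_algebraB (τ r M sn n S K T c : ℝ) (hr : r ^ 2 = M) (hM : 0 < M) (hsn : sn ^ 2 = n) (hn : 0 < n) (hc : 0 < c) :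
    τ / (2 * (c * r) ^ 4) * ((1 / sn) * S) ^ 2 * (5 * (T / r) ^ 2 + K) = τ * S ^ 2 * (5 * T ^ 2 + M * K) / (2 * c ^ 4 * n * M ^ 3) := by
  have hr0 : r ≠ 0 := by rintro rfl; simp at hr; linarith
  have hsn0 : sn ≠ 0 := by rintro rfl; simp at hsn; linarith
  have hr4 : (c * r) ^ 4 = c ^ 4 * M ^ 2 := by rw [mul_pow, show r ^ 4 = (r ^ 2) ^ 2 by ring, hr]
  have e2 : ((1 / sn) * S) ^ 2 = S ^ 2 / n := by rw [mul_pow, one_div, inv_pow, hsn]; ring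
  have e3 : (T / r) ^ 2 = T ^ 2 / M := by rw [div_pow, hr]
  rw [hr4, e2, e3]
  field_simp

/-- `|m|² > 0` for admissible slot data. -/
theorem sqm_pos (d : SlotData) (h : d.ok) : 0 < sqm d := by
  unfold sqm
  rcases h.1 with h0 | h0 | h0
  · have : (d.m 0 : ℝ) ≠ 0 := by exact_mod_cast h0
    positivity
  · have : (d.m 1 : ℝ) ≠ 0 := by exact_mod_cast h0
    positivity
  · have : (d.m 2 : ℝ) ≠ 0 := by exact_mod_cast h0
    positivity

/-- `norm_sq_latticeVec` (p5 g8, OddGainDefect §2; see the file header). -/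
theorem norm_sq_latticeVec (d : SlotData) : ‖Torus.latticeVec d.m‖ ^ 2 = sqm d := by
  rw [norm_sq_fin_three]; simp only [Torus.latticeVec_apply, sqm]

/-- `mkPhase_e_dot` (p5 g8, OddGainDefect §2; see the file header). -/
theorem mkPhase_e_dot (d : SlotData) (h : d.ok) (κ : Fin 3 → ℝ) :
    ∑ a, (mkPhase d h).e a * κ a = (1 / Real.sqrt d.n) * ((d.v 0 : ℝ) * κ 0 + d.v 1 * κ 1 + d.v 2 * κ 2) := by
  have he : ∀ a, (mkPhase d h).e a = (1 / Real.sqrt d.n) * d.v a := by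
    intro a
    show ((1 / Real.sqrt d.n) • Torus.latticeVec d.v) a = _
    rw [PiLp.smul_apply, smul_eq_mul, Torus.latticeVec_apply]
  simp only [Fin.sum_univ_three, he]
  ring

/-- `mhat_mkPhase_dot` (p5 g8, OddGainDefect §2; see the file header). -/
theorem mhat_mkPhase_dot (d : SlotData) (h : d.ok) (x : Fin 3 → ℝ) :
    mhat (mkPhase d h) ⬝ᵥ x = ((d.m 0 : ℝ) * x 0 + d.m 1 * x 1 + d.m 2 * x 2) / ‖Torus.latticeVec d.m‖ := by
  have hm : ∀ a, mhat (mkPhase d h) a = (d.m a : ℝ) / ‖Torus.latticeVec d.m‖ := by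
    intro a
    show (Torus.latticeVec d.m) a / ‖Torus.latticeVec d.m‖ = _
    rw [Torus.latticeVec_apply]
  rw [real_dot_eq, hm, hm, hm]
  ring

/-- PER SLOT: `c_s(e_s·κ)²·|P_s v|² = slotTermP_s(κ, v)/period`. [folklore] -/
theorem slotW_mul_perpSq (κ v : Fin 3 → ℝ) (s : Fin 26) :
    slotW κ s * perpSq (slotN s) v = slotTermP (slots s) κ v / 3720 := by
  have hn : (0 : ℝ) < (slots s).n := by exact_mod_cast (slots_ok s).2.1
  have h := slot_algebraP ((slots s).τ : ℝ) ‖Torus.latticeVec (slots s).m‖ (sqm (slots s)) (Real.sqrt (slots s).n) (slots s).n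
    (((slots s).v 0 : ℝ) * κ 0 + (slots s).v 1 * κ 1 + (slots s).v 2 * κ 2) (v 0 ^ 2 + v 1 ^ 2 + v 2 ^ 2)
    (((slots s).m 0 : ℝ) * v 0 + (slots s).m 1 * v 1 + (slots s).m 2 * v 2) (2 * π)
    (norm_sq_latticeVec _) (sqm_pos _ (slots_ok s)) (Real.sq_sqrt hn.le) hn (by positivity)
  have hps : perpSq (slotN s) v = (v 0 ^ 2 + v 1 ^ 2 + v 2 ^ 2) -
      ((((slots s).m 0 : ℝ) * v 0 + (slots s).m 1 * v 1 + (slots s).m 2 * v 2) / ‖Torus.latticeVec (slots s).m‖) ^ 2 := by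
    rw [perpSq, dotProduct_comm, slotN, show cubatureWord.phase s = mkPhase (slots s) (slots_ok s) from rfl, mhat_mkPhase_dot,
      real_dot_eq]
    ring
  rw [slotW, slotCoef, period_cubatureWord, show cubatureWord.phase s = mkPhase (slots s) (slots_ok s) from rfl, mkPhase_e_dot, hps]
  show ((slots s).τ : ℝ) / (2 * (2 * π * ‖Torus.latticeVec (slots s).m‖) ^ 4) / 3720 * _ * _ = _
  rw [slotTermP, ← h]
  ring

/-- PER SLOT: `c_s(e_s·κ)²·(5(m̂_s·κ)² + |κ|²) = slotTermB_s(κ)/period`. [folklore] -/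
theorem slotW_mul_moment (κ : Fin 3 → ℝ) (s : Fin 26) :
    slotW κ s * (5 * (slotN s ⬝ᵥ κ) ^ 2 + κ ⬝ᵥ κ) = slotTermB (slots s) κ / 3720 := by
  have hn : (0 : ℝ) < (slots s).n := by exact_mod_cast (slots_ok s).2.1
  have h := slot_algebraB ((slots s).τ : ℝ) ‖Torus.latticeVec (slots s).m‖ (sqm (slots s)) (Real.sqrt (slots s).n) (slots s).n
    (((slots s).v 0 : ℝ) * κ 0 + (slots s).v 1 * κ 1 + (slots s).v 2 * κ 2) (κ 0 ^ 2 + κ 1 ^ 2 + κ 2 ^ 2)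
    (((slots s).m 0 : ℝ) * κ 0 + (slots s).m 1 * κ 1 + (slots s).m 2 * κ 2) (2 * π)
    (norm_sq_latticeVec _) (sqm_pos _ (slots_ok s)) (Real.sq_sqrt hn.le) hn (by positivity)
  have hμ : slotN s ⬝ᵥ κ = (((slots s).m 0 : ℝ) * κ 0 + (slots s).m 1 * κ 1 + (slots s).m 2 * κ 2) / ‖Torus.latticeVec (slots s).m‖ := by
    rw [slotN, show cubatureWord.phase s = mkPhase (slots s) (slots_ok s) from rfl, mhat_mkPhase_dot]
  have hkk : κ ⬝ᵥ κ = κ 0 ^ 2 + κ 1 ^ 2 + κ 2 ^ 2 := by rw [real_dot_eq]; ring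
  rw [slotW, slotCoef, period_cubatureWord, show cubatureWord.phase s = mkPhase (slots s) (slots_ok s) from rfl, mkPhase_e_dot, hμ, hkk]
  show ((slots s).τ : ℝ) / (2 * (2 * π * ‖Torus.latticeVec (slots s).m‖) ^ 4) / 3720 * _ * _ = _
  rw [slotTermB, ← h]
  ring

/-- **LOWER FRAME CONSTANT `a = c₀`**: on `κ⊥`, `Σ_s c_s(e_s·κ)²|P_s v|² = c₀|v|²` (an EQUALITY — the isotropy of `W₀`,
`isotropicWordGain_cubatureWord`, in the transverse-projector form). [folklore] -/
theorem slotW_perpSq_sum (κ v : Fin 3 → ℝ) (hκ : κ ⬝ᵥ κ = 1) (hv : v ⬝ᵥ κ = 0) :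
    ∑ s, slotW κ s * perpSq (slotN s) v = c0 * (v ⬝ᵥ v) := by
  have hsum : ∑ s, slotW κ s * perpSq (slotN s) v = (∑ j, slotTermP (slots j) κ v) / 3720 := by
    rw [Finset.sum_div]; exact Finset.sum_congr rfl fun s _ => slotW_mul_perpSq κ v s
  have hκ' : κ 0 ^ 2 + κ 1 ^ 2 + κ 2 ^ 2 = 1 := by rw [real_dot_eq] at hκ; linear_combination hκ
  have hv' : κ 0 * v 0 + κ 1 * v 1 + κ 2 * v 2 = 0 := by rw [real_dot_eq] at hv; linear_combination hv
  rw [hsum, slotTermP_sum, hκ', hv', real_dot_eq]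
  unfold c0
  field_simp
  ring

/-- **FIRST ABSOLUTE MOMENT `B ≤ c₀√5/3`**: `Σ_s c_s(e_s·κ)²|m̂_s·κ| ≤ c₀·√5/3` for unit `κ` (AM–GM `2√5|μ| ≤ 5μ² + 1` slot by
slot, then design identity 2). [folklore] -/
theorem slotW_abs_sum_le (κ : Fin 3 → ℝ) (hκ : κ ⬝ᵥ κ = 1) :
    ∑ s, slotW κ s * |slotN s ⬝ᵥ κ| ≤ c0 * Real.sqrt 5 / 3 := by
  have hs5 : Real.sqrt 5 ^ 2 = 5 := Real.sq_sqrt (by norm_num)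
  have h5 : 0 < Real.sqrt 5 := Real.sqrt_pos.2 (by norm_num)
  -- AM–GM slot by slot
  have hslot : ∀ s, 2 * Real.sqrt 5 * (slotW κ s * |slotN s ⬝ᵥ κ|) ≤ slotW κ s * (5 * (slotN s ⬝ᵥ κ) ^ 2 + κ ⬝ᵥ κ) := by
    intro s
    have hw := slotW_nonneg κ s
    have ham : 2 * Real.sqrt 5 * |slotN s ⬝ᵥ κ| ≤ 5 * (slotN s ⬝ᵥ κ) ^ 2 + 1 := by
      nlinarith [sq_nonneg (Real.sqrt 5 * |slotN s ⬝ᵥ κ| - 1), sq_abs (slotN s ⬝ᵥ κ), hs5]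
    rw [hκ]
    nlinarith [mul_le_mul_of_nonneg_left ham hw]
  have hsum : ∑ s, slotW κ s * (5 * (slotN s ⬝ᵥ κ) ^ 2 + κ ⬝ᵥ κ) = 560 / (119040 * π ^ 4) := by
    have hκ' : κ 0 ^ 2 + κ 1 ^ 2 + κ 2 ^ 2 = 1 := by rw [real_dot_eq] at hκ; linear_combination hκ
    rw [show ∑ s, slotW κ s * (5 * (slotN s ⬝ᵥ κ) ^ 2 + κ ⬝ᵥ κ) = (∑ j, slotTermB (slots j) κ) / 3720 by
      rw [Finset.sum_div]; exact Finset.sum_congr rfl fun s _ => slotW_mul_moment κ s]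
    rw [slotTermB_sum, hκ']
    field_simp
    norm_num
  have key : 2 * Real.sqrt 5 * ∑ s, slotW κ s * |slotN s ⬝ᵥ κ| ≤ 560 / (119040 * π ^ 4) := by
    rw [← hsum, Finset.mul_sum]
    exact Finset.sum_le_sum fun s _ => hslot s
  have e : 2 * Real.sqrt 5 * (c0 * Real.sqrt 5 / 3) = 560 / (119040 * π ^ 4) := by
    rw [show 2 * Real.sqrt 5 * (c0 * Real.sqrt 5 / 3) = 2 * c0 * Real.sqrt 5 ^ 2 / 3 by ring, hs5]
    unfold c0
    field_simp
    norm_num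
  have h2 : 2 * Real.sqrt 5 * ∑ s, slotW κ s * |slotN s ⬝ᵥ κ| ≤ 2 * Real.sqrt 5 * (c0 * Real.sqrt 5 / 3) := by rw [e]; exact key
  exact le_of_mul_le_mul_left h2 (by positivity)

/-- **STRICT REVERSED MINKOWSKI FOR THE CUBATURE WORD** (the odd-gain certificate (L4), ELEMENTARY, explicit constant):
for a unit output direction `κ`, `p, q ⊥ κ`, and slot response matrices `M_s` in the common transverse window
`y|P_s x|² ≤ xᵀM_s x ≤ c·y·|P_s x|²` (`y, c ≥ 0`),
`Σ_s c_s(e_s·κ)² √(gram2 M_s p q) ≤ (c·√5/3) · √(gram2 (Σ_s c_s(e_s·κ)² M_s) p q)`.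
Hence the contraction factor `γ(c) = c·√5/3 < 1` for every box ratio `c < 3/√5 ≈ 1.3416`. [folklore] -/
theorem strictMinkowski_cubatureWord (κ p q : Fin 3 → ℝ) (hκ : κ ⬝ᵥ κ = 1) (hp : p ⬝ᵥ κ = 0) (hq : q ⬝ᵥ κ = 0)
    (M : Fin 26 → Matrix (Fin 3) (Fin 3) ℝ) {y c : ℝ} (hy : 0 ≤ y) (hc : 0 ≤ c)
    (hwin : ∀ s x, y * perpSq (slotN s) x ≤ x ⬝ᵥ (M s) *ᵥ x ∧ x ⬝ᵥ (M s) *ᵥ x ≤ c * y * perpSq (slotN s) x) :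
    ∑ s, slotW κ s * Real.sqrt (gram2 (M s) p q) ≤ (c * Real.sqrt 5 / 3) * Real.sqrt (gram2 (∑ s, slotW κ s • M s) p q) := by
  have h := strictMinkowski_gram (Finset.univ : Finset (Fin 26)) (slotW κ) slotN M κ p q hy hc c0_pos
    (fun s _ => slotW_nonneg κ s) (fun s _ => slotN_unit s) hκ hp hq (fun s _ x => hwin s x)
    (fun v hv => (slotW_perpSq_sum κ v hκ hv).symm.le) (slotW_abs_sum_le κ hκ)
  have e : c * (c0 * Real.sqrt 5 / 3) / c0 = c * Real.sqrt 5 / 3 := by field_simp [c0_pos.ne']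
  rwa [e] at h

/-- … so a contraction factor `γ < 1` EXISTS for every box ratio `c < 3/√5`. [folklore] -/
theorem gamma_lt_one {c : ℝ} (hc' : c < 3 / Real.sqrt 5) : c * Real.sqrt 5 / 3 < 1 := by
  have h5 : 0 < Real.sqrt 5 := Real.sqrt_pos.2 (by norm_num)
  rw [lt_div_iff₀ h5] at hc'
  linarith

end Cubature


end Summit.AnomalousDissipation.AnomalousDissipation.Theorems.SolenoidalFractalHomogenisation.LagrangianStep.OddGain

end
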